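import Summits.CriticalPhenomena.PercolationContinuityZ3.Theorems.Transplant.SkelPhiConcReachRun
import Summits.CriticalPhenomena.PercolationContinuityZ3.Theorems.Transplant.SkelPhiWinChainKitsHab
import HarnessLib

/-!
# Residue (C) of route D″ v2, STRUCTURE-FREE generic layer, KIT DISCHARGE (DPRIME-SCOPE §2 (C), addenda K/M/N; rulings R1–R3 05:09:29Z, M.9,
# R1-strides 05:53:45Z): the rim-covering per-step kit premise of `Skelφ.reachOblRH_of_schedules` (SkelPhiConcReachRun) DISCHARGED from the
# Step-I′ certificate at the running density through p1-g9's habitat kit clause `Skelφ.kitClauseHab_stepI` (SkelPhiKitsStepIHab) — for every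
# probe the plain window is centred at the ROOT `t` with depth `R := (E − L′) + r₀` (`E = E(nQ α y)` the habitat radius of the probe), so that
# (i) the plain levels and the plain window over every region lie in the fresh habitat (`R + 1 ≤ E − 2`, i.e. `r₀ + 3 ≤ L′ ≤ E₀`), and (ii) far
# plain contacts (`∉ B(t, R − r₀) = B(t, E − L′)`) and padded contacts (inner neighbour `∉ B(t, R − 1) ⊆ …`) send their inner neighbours into
# the RIM PART, which by the covering clause holds every region vertex beyond depth `E − L′`; result **`Skelφ.reachOblRH_of_stepI`**:
# `Skel.ReachOblRH` for the two-unit scheme of record from per-probe planar schedules, the radii rooms, the excess radius, the count, the kit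
# data with its slab/shell rooms, the route rooms of the schedules, and the Step-I′ family at `q` (threshold `1 − δ²`)

builds on p205010 (kernel theorem, internal audit signed; external expert review pending) — nothing in this file uses p205010.
Lane `prim-bschramm`, seat `prim-bschramm-p5` (gen 6; (C) column of the D″ order of battle), helper file (`--supports stmt-CriticalPhenomena-4575 --as helper`).
φ-level successor of `SkelConcReachClauses` (p5-g4/p3-g5) in the schedule-generic design; consumes p1-g9's LEVEL 1 (b)+(c′) exactly as landed (K2).
[cite: KozmaNitzan2024, §4 Lemma 10 Steps III–V (pp. 19–22), Lemma 11 (pp. 22–23), Lemma 12 (pp. 23–25), p. 30 (Step IV), p. 31]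
-/

noncomputable section

open MeasureTheory

namespace Summit.CriticalPhenomena.PercolationContinuityZ3.Theorems

namespace Transplant

namespace Skelφ

open Literature.Probability.Percolation Literature.Probability.LatticeModels SimpleGraph GadgetSystem ProbeHistory HSiteScheme Contour KNCells
open KNCells.KSchA KNLevels ChainPlanar
open Literature.Probability.Percolation.GM
open Literature.Probability.Percolation.KozmaNitzan.Cells (oth sgOf stepVec_apply_fst stepVec_apply_oth)
open Literature.Barriers.CriticalPhenomena (graphBall graphBall_finite mem_graphBall_self graphBall_mono)
open BoxProdZ2 (ConcRadiiG nQ nS Erad Frad Erad_mono Frad_succ Frad_le_Erad Erad_add_gap_le_Frad_succ add_mul_le_Erad)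
open Skel (excess winGraph winGraphIn winGraphIn_le nmaxC ReachOblAtH ReachOblRH l1_tgt_le_nQ isSubbox_Wcor_hab)
open SkelI (tanOff)

open scoped Classical

variable {V : Type} [DecidableEq V] {G : SimpleGraph V} [G.LocallyFinite] {φ : V → Site 2} {types : Finset V}

/-- **RESIDUE (C) AT RUN HISTORIES FROM THE STEP-I′ CERTIFICATE** (two-unit scheme of record, habitat form, per-probe planar schedules).
`Skelφ.reachOblRH_of_schedules` with its per-step kit premise discharged by `Skelφ.kitClauseHab_stepI`: the inputs are the planar map's dictionary
(`hlip hstep hfr hκ hΔ hC`), the Step-I′ data `D` over the shifted fat prisms and the family at `q` with threshold `1 − δ²` over the finite lists,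
the scheme `⟨cellGeomSG G φ P t (concRadii2S P gap gap' E₀ L'), q, δc⟩` with its radii rooms, the excess radius, the count, the schedules
`SchOf y du` with their three planar rooms, length and radius, the kit (zone scale, extents, half-widths, radii) with the slab/shell rooms of
`kitClause'`, the ROUTE ROOMS of the schedules (extents beyond the zone scale and certified along the step's axis, depth `≤ r₀`, certified widths
below the schedule's spread), the depth budget `r₀ + 3 ≤ L' ≤ E₀`, and the kit number. [cite: KozmaNitzan2024, §4 Lemmas 10–12 (pp. 17–25), p. 31] -/
theorem reachOblRH_of_stepI [Countable V] (hlip : Lip G φ) (hstep : Steps G φ) (hfr : Frames G φ types) (hκ : CylConn G φ types)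
    {Δ : ℕ} (hΔ : ∀ v, G.degree v ≤ Δ) {p : unitInterval} (hC : CylSubcritical G φ types p) {D : StepI.Data V} {off : ℕ}
    (hD : D.Λ = fatSeqOff hfr hC off) {Sz Sx Sy : Finset ℕ} (q : unitInterval) {δ : ℝ} (hδ : 0 < δ)
    (h : ∀ i ∈ StepI.index types Sz Sx Sy, 1 - δ ^ 2 < (bondPercolation G q).real (StepI.event G φ D i))
    -- the scheme of record and its radii rooms
    (P : PCells2) (t : V) (gap gap' : ℕ → ℕ) (E₀ L' : ℕ) (δc : ℝ) {R' Rlev N j₀ j₁ : ℕ} (hRl : Rlev + 1 ≤ R') (hj : j₁ ≤ Rlev)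
    (hΛ : WFS2 P (concRadii2S P gap gap' E₀ L')) (hφ : φ t = 0) (hgap : ∀ n, 20 * P.rmax ≤ gap n) (hE₀ : 44 * P.rmax + 3 ≤ E₀)
    (hgapL : ∀ ρ, L' ≤ gap ρ)
    -- the planar schedules of the probes
    (SchOf : Site 2 → MDir → Schedule) (hM0 : ∀ y du, P.M y ⊆ (SchOf y du).core 0)
    (hreg : ∀ y du, ∀ k ≤ (SchOf y du).N, (SchOf y du).region k ⊆ P.Q y ∪ P.Hfull y du)
    (hlast : ∀ y du, (SchOf y du).core ((SchOf y du).N + 1) ⊆ P.M (y + stepVec du) ∩ P.Hfull y du)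
    (hn : ∀ y du, (SchOf y du).N ≤ nmaxC) (hR' : ∀ y du, (SchOf y du).R' = R')
    -- the count and the excess
    {η : ℝ} (hcount : 1 / (1 - (q : ℝ)) ^ (Δ * N) ≤ δ * ((Finset.Icc j₀ j₁).card : ℝ)) (hη : η ≤ δ / 2)
    {Rex : ℕ → ℕ}
    (hRex : ∀ R₀' R₁, Rex R₀' ≤ R₁ → ∀ (Rw : ℕ) (D' A' : Finset V), (∀ d ∈ D', d ∈ graphBall G t Rw) →
      (∀ d ∈ D', ∀ d' ∈ D', φ d - φ d' ∈ box 2 (50 * P.rmax)) → A' ⊆ D' → (∀ a ∈ A', a ∈ graphBall G t R₀') →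
        (bondPercolation G q).real (excess G t R₁ D' A') ≤ η)
    (hsch : ∀ g, Rex (Erad gap gap' E₀ g + 1) + L' ≤ Erad gap gap' E₀ (g + 1))
    -- the kit: zone scale, certified extents, half-widths, radii, and the slab/shell rooms of `kitClause'`
    {Mz : ℕ} (hMz : Mz ∈ Sz) (hkz : D.k ≤ Mz) {ℓK : Fin 2 → ℕ} (hℓK0 : ∀ I, I = 0 → ℓK I ∈ Sx) (hℓK1 : ∀ I, I = 1 → ℓK I ∈ Sy)
    {A : Fin 2 → Fin 2 → ℕ} {Rk : Fin 2 → ℕ} (hAw : ∀ I, A I = StepI.widths D.Gb D.Fb I (ℓK I)) (hRk : ∀ I, Rk I = D.R (amax (A I)))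
    {ℓs M K R'k r₀ rs : ℕ} (hℓs : 1 ≤ ℓs) (hj₀ : tanOff ℓs M ≤ j₀)
    (hA : ∀ i k, A i k ≤ M) (hAℓ : ∀ i, A i (oth i) ≤ ℓs) (hK : ∀ i, ℓs + 1 + A i i + Rk i ≤ K)
    (hnA : ∀ i, Mz + 1 ≤ A i i) (hnM : Mz ≤ M) (hρK : ∀ i, ℓs + 1 + A i i + (fatRadius hfr hC Mz + off) ≤ K)
    (hR'₁ : cylRadMax G φ types ℓs (ℓs + 2 + 2 * tanOff ℓs M) ≤ R'k) (hR'₂ : ∀ i, cylRadMax G φ types ℓs (ℓs + 2 + A i i + Rk i) ≤ R'k)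
    (hr₀₁ : ℓs + 1 + tanOff ℓs M + R'k ≤ r₀) (hr₀₂ : ℓs + 2 + tanOff ℓs M + K ≤ r₀)
    (hrs₁ : ℓs + 2 + tanOff ℓs M + R'k ≤ rs) (hrs₂ : ℓs + 2 + tanOff ℓs M + K ≤ rs) {cU : ℕ} (hcU : ∀ i, (Δ + 1) ^ Rk i ≤ cU)
    -- the route rooms of the schedules
    (hMℓ : ∀ y du, Mz + 1 ≤ (SchOf y du).ℓ₀)
    (hS0 : ∀ y du k, (SchOf y du).ax k = 0 → ∀ ℓ, (SchOf y du).ℓ₀ ≤ ℓ → ℓ ≤ (SchOf y du).ℓ₁ → ℓ ∈ Sx)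
    (hS1 : ∀ y du k, (SchOf y du).ax k = 1 → ∀ ℓ, (SchOf y du).ℓ₀ ≤ ℓ → ℓ ≤ (SchOf y du).ℓ₁ → ℓ ∈ Sy)
    (hdepth : ∀ y du k, ∀ I ℓ, (SchOf y du).ℓ₀ ≤ ℓ → ℓ ≤ (SchOf y du).ℓ₁ →
      2 * ℓs + 2 + tanOff ℓs M + A I I + D.R (amax (StepI.widths D.Gb D.Fb ((SchOf y du).ax k) ℓ)) ≤ r₀)
    (hWr : ∀ y du k, ∀ ℓ, (SchOf y du).ℓ₀ ≤ ℓ → ℓ ≤ (SchOf y du).ℓ₁ →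
      StepI.widths D.Gb D.Fb ((SchOf y du).ax k) ℓ (oth ((SchOf y du).ax k)) ≤ (SchOf y du).Wb k ℓ)
    -- the depth budget: plain windows of depth `(E − L') + r₀` lie in the habitat of radius `E ≥ E₀`
    (hr₀L : r₀ + 3 ≤ L') (hL'E : L' ≤ E₀)
    -- the kit number
    (kk : ℕ) (hN : kk * (Δ + 1) ^ (2 * rs) ≤ N)
    (hkk : (1 - (q : ℝ) ^ (1 + Δ * ((Δ + 1) ^ R'k + (tanOff ℓs M + 2)) + ((Δ + 1) ^ R'k + (tanOff ℓs M + 2)) * cU)) ^ kk ≤ δ) :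
    ReachOblRH G (⟨cellGeomSG G φ P t (concRadii2S P gap gap' E₀ L'), q, δc⟩ : KSchA V ℕ)
      (faceDataSG G φ P t (concRadii2S P gap gap' E₀ L')) Δ δ := by
  refine reachOblRH_of_schedules hlip hstep P t gap gap' E₀ L' q δc hRl hj hΛ hφ hgap hE₀ hgapL SchOf hM0 hreg hlast hn hR' hcount hη hRex
    hsch ?_
  intro ω n e hc hV du hdu Pd hPo hPS hPRlev hPN hPj₀ hPj₁ hcover k hk j hjm
  have hE₀1 : 1 ≤ E₀ := by omega
  -- the radii at the realised triple
  obtain ⟨hEQ, -, hρ, -, -, -⟩ := reach_radii_concSG (P := P) (t := t) (gap := gap) (gap' := gap') (E₀ := E₀) (L' := L')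
    (q := q) (δc := δc) hgap hE₀1 hφ hc hV hdu
  -- abbreviations (after the radii, so that the arithmetic sees one atom per radius)
  set S : KSchA V ℕ := ⟨cellGeomSG G φ P t (concRadii2S P gap gap' E₀ L'), q, δc⟩ with hSdef
  set Λ := concRadii2S P gap gap' E₀ L' with hΛdef
  set α := S.aOf₁ G (S.hst₂ G ω n) e with hαdef
  set β := S.aOf₂ G (S.hst₂ G ω n) e with hβdef
  set y := tgt e with hydef
  set Ω := habΩ G φ P t (Λ := Λ) q δc (S.hst₂ G ω n) e β du with hΩdef
  set 𝒲 := planarWindowIn hlip Ω with h𝒲def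
  set Sch := SchOf y du with hSchdef
  set E := Erad gap gap' E₀ (nQ α y) with hEdef
  -- the depth budget: `R := (E − L') + r₀`, `R + 1 ≤ E − 2`, `R − r₀ = E − L'`
  have hEge : E₀ ≤ E := by
    have := add_mul_le_Erad gap' E₀ hgap (nQ α y)
    rw [← hEdef] at this; exact le_trans (Nat.le_add_right _ _) this
  set R := E - L' + r₀ with hRdef
  have hRr₀ : r₀ ≤ R := Nat.le_add_left _ _
  have hRsub : R - r₀ = E - L' := Nat.add_sub_cancel _ _
  have hR3 : R + 1 ≤ E - 2 := by omega
  -- the onward direction is not the way back (the source column is explored)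
  have hdur : du ≠ rev e.2 := by
    rintro rfl
    obtain ⟨y', hy', hyc⟩ := hV.src_mem
    have h1 := (Finset.mem_filter.1 hdu).2 y' hy'
    rw [show tgt e + stepVec (rev e.2) = e.1 from tgt_tgt_rev e] at h1
    exact h1 hyc
  -- the records
  have hL := levelGeomSG P t hΛ hlip (Λ := Λ)
  have hQ : QSepGeom G S.Γ := qSepGeomSG P t hlip (Λ := Λ)
  have hSt := stepsGeomSG P t hΛ hstep (Λ := Λ)
  have ha'' : β ∈ S.Γ.anchSet α y := hV.anch
  have hΩeq : Ω = S.Γ.Ewv α e.1 e.2 ∪ (faceDataSG G φ P t Λ).Hfull β y du := rfl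
  -- plain windows of depth `R` over planar sets inside `Q_y ∪ H_{y,du}` lie in the habitat
  have hWinΩ : ∀ Pl : Finset (Site 2), Pl ⊆ P.Q y ∪ P.Hfull y du → Win G φ t Pl R ⊆ Ω := by
    intro Pl hPl v hv
    obtain ⟨hvB, hvP⟩ := (mem_Win G φ).1 hv
    rcases Finset.mem_union.1 (hPl hvP) with hxQ | hxH
    · have hgQ : v ∈ VWin G φ t (P.Q y) (Λ.rQ α y) :=
        mem_VWin_of_zdAdj hstep hvB (by rw [hEQ]; omega) hxQ (P.exists_adj_of_mem_Q _ hxQ)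
      exact Finset.mem_union_left _ (Finset.mem_union_right _ hgQ)
    · obtain ⟨t', ht', hadj⟩ := P.exists_adj_of_mem_Hfull y du hxH
      have h1 : R + 1 ≤ prof P Λ β y du t' := by unfold prof; rw [hρ]; omega
      have h2 : R + 1 ≤ prof P Λ β y du (φ v) := by unfold prof; rw [hρ]; omega
      exact Finset.mem_union_right _ (mem_VStair_of_zdAdj hstep hvB hxH ⟨t', ht', hadj, h1⟩ h2)
  -- the level window
  have hjj : j ≤ Pd.j₁ := (Finset.mem_Icc.1 hjm).2
  have hj0 : tanOff ℓs M ≤ j := by rw [hPj₀] at hjm; exact hj₀.trans (Finset.mem_Icc.1 hjm).1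
  have hjP : Pd.j₁ ≤ Pd.Rlev := by rw [hPj₁, hPRlev]; exact hj
  have hRlP : Pd.Rlev + 1 ≤ Sch.R' := by rw [hPRlev, hSchdef, hR' y du]; exact hRl
  have hjR : j ≤ Sch.R' := (hjj.trans hjP).trans (by omega)
  have hregk : Sch.region k ⊆ P.Q y ∪ P.Hfull y du := hreg y du k hk
  have hlevk : Sch.level k j ⊆ P.Q y ∪ P.Hfull y du := (Sch.level_subset_region hk hjR).trans hregk
  have hfull : winLevel G φ t R (Sch.lo k) (Sch.hi k) j ⊆ Ω := hWinΩ _ hlevk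
  have hPΩ : Win G φ t (Sch.region k) R ⊆ Ω := hWinΩ _ hregk
  -- the region lies in the fresh habitat and in the habitat proper; the corridor law is a subbox on it
  have hDΩ : 𝒲.stepD Sch k ⊆ S.Γ.Ewv α e.1 e.2 ∪ (faceDataSG G φ P t Λ).Hfull β y du := fun v hv => by
    rw [← hΩeq]; exact ((mem_WinIn (φ := φ)).1 hv).1
  have hDh : 𝒲.stepD Sch k ⊆ S.Γ.Q α y ∪ S.Γ.Efar β y du := by
    intro v hv
    obtain ⟨hvΩ, hvφ⟩ := (mem_WinIn (φ := φ)).1 hv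
    rcases mem_Q_or_Hfull_of_mem_habΩ hdur hvΩ (hregk hvφ) with hvQ | hvH
    · exact Finset.mem_union_left _ hvQ
    · exact hSt.Hfull_subset _ _ _ _ ha'' hvH
  have hsub : IsSubbox (winGraphIn G Ω) (S.Wcor G (faceDataSG G φ P t Λ) (S.hst₂ G ω n) e α β du) q (𝒲.stepD Sch k) :=
    isSubbox_Wcor_hab hL hQ hSt hV hdu ha'' hDΩ hDh
  -- the slab room of the level box (`j ≥ j₀ ≥ T₀`, cores nonempty)
  have hlohi : Sch.lo k ≤ Sch.hi k := Finset.nonempty_Icc.1 (Sch.nonempty k (hk.trans (Nat.le_succ _)))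
  have hwidej : ∀ i, (Sch.lo k - (j : Site 2)) i + 2 * tanOff ℓs M ≤ (Sch.hi k + (j : Site 2)) i := fun i => by
    have := hlohi i
    have hj0' : (tanOff ℓs M : ℤ) ≤ j := by exact_mod_cast hj0
    simp only [Pi.sub_apply, Pi.add_apply, Pi.natCast_apply]
    linarith
  have hXD : winLevelIn φ Ω (Sch.lo k) (Sch.hi k) j ⊆ 𝒲.stepD Sch k := winLevelIn_subset_stepD_in hlip Sch Ω hk hjR
  have hPD : Win G φ t (Sch.region k) R ⊆ 𝒲.stepD Sch k := fun v hv =>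
    (mem_WinIn φ).2 ⟨hPΩ hv, ((mem_Win G φ).1 hv).2⟩
  have hPT : Win G φ t (Sch.core (k + 1)) R ⊆ Pd.coreE 𝒲 Sch k := fun v hv =>
    Finset.mem_union_left _ ((mem_WinIn φ).2 ⟨hPΩ (Win_mono G φ (Sch.core_succ_subset_region hk) le_rfl hv), ((mem_Win G φ).1 hv).2⟩)
  -- far plain contacts and padded contacts send their inner neighbours into the rim part
  have hfarT : ∀ x ∈ outerBoundary (winGraph G t R) (winLevel G φ t R (Sch.lo k) (Sch.hi k) j),
      inNbr G φ t R (Finset.Icc (Sch.lo k - (j : Site 2)) (Sch.hi k + (j : Site 2))) x ∉ graphBall G t (R - r₀) →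
      inNbr G φ t R (Finset.Icc (Sch.lo k - (j : Site 2)) (Sch.hi k + (j : Site 2))) x ∈ Pd.coreE 𝒲 Sch k := by
    intro x hx hfar
    have hmem : inNbr G φ t R (Finset.Icc (Sch.lo k - (j : Site 2)) (Sch.hi k + (j : Site 2))) x ∈
        winLevel G φ t R (Sch.lo k) (Sch.hi k) j := inNbr_mem_Win hx
    have hφm := ((mem_Win G φ).1 hmem).2
    have hD : inNbr G φ t R (Finset.Icc (Sch.lo k - (j : Site 2)) (Sch.hi k + (j : Site 2))) x ∈ 𝒲.stepD Sch k :=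
      hXD ((mem_winLevelIn_iff φ).2 ⟨hfull hmem, hφm⟩)
    rw [hRsub] at hfar
    exact Finset.mem_union_right _ (hcover k _ hD hfar)
  have hpadT : ∀ x ∈ outerBoundary (winGraphIn G Ω) (winLevelIn φ Ω (Sch.lo k) (Sch.hi k) j),
      x ∉ outerBoundary (winGraph G t R) (winLevel G φ t R (Sch.lo k) (Sch.hi k) j) →
      inNbrIn G φ Ω (Finset.Icc (Sch.lo k - (j : Site 2)) (Sch.hi k + (j : Site 2))) x ∈ Pd.coreE 𝒲 Sch k := by
    intro x hx hxn
    have hD : inNbrIn G φ Ω (Finset.Icc (Sch.lo k - (j : Site 2)) (Sch.hi k + (j : Site 2))) x ∈ 𝒲.stepD Sch k :=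
      hXD (inNbrIn_mem_winLevelIn hx)
    have hfar := inNbrIn_not_mem_graphBall hx hxn (d := E - L') (by omega)
    exact Finset.mem_union_right _ (hcover k _ hD hfar)
  -- the kit clause of the habitat level
  have hN' : kk * (Δ + 1) ^ (2 * rs) ≤ Pd.N := by rw [hPN]; exact hN
  exact kitClauseHab_stepI hlip hstep hfr hκ hΔ hC hD hδ h hMz hkz hℓK0 hℓK1 hAw hRk hℓs hwidej hA hAℓ hK hnA hnM hρK hR'₁ hR'₂ hr₀₁
    hr₀₂ hRr₀ hrs₁ hrs₂ hcU (Sch.ax k) (hMℓ y du) (hS0 y du k) (hS1 y du k) (hdepth y du k) (hWr y du k) (Pd.roomS Sch hRlP hjP hk j hjj)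
    hfull kk Pd.o Pd.Sfin hsub hXD hPΩ hPD hPT hfarT hpadT hN' hkk

end Skelφ

end Transplant

end Summit.CriticalPhenomena.PercolationContinuityZ3.Theorems

end
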